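import Mathlib
import Literature.Combinatorics.Enumerative.AperyNumbers
import Literature.NumberTheory.Transcendental.AperyTable

/-!
# AperyDworkCongruenceAux — `p`-adic bookkeeping for `p³·b_{kp} ≡ b_k (mod p)` (cell zeta5-irr, zi-p2 target T-B8.2)

HONEST FRAMING: systematic search; no irrationality claim unless certified. INSTRUMENT lemmas of the ζ(5)
census cell zeta5-irr (HOME `run/shared/lean/pub/zeta5-irr/`; memo `zi-p2/LEMMAS.md` §B8-a «TOP-LAYER DIGIT
LAW»; finding `zi-p2/FINDINGS-DENOM.md` §2.10). Nothing here is about ζ(5); filing moves no rung. Filed by zi-eng (g3).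
Contents: Apéry's second solution in EXPLICIT form `b_n = Σ_{j≤n} C(n,j)²C(n+j,j)²·c_{n,j}`,
`c_{n,j} = Σ_{m≤n} m⁻³ + Σ_{i=1}^{j} (−1)^{i−1}/(2i³C(n,i)C(n+i,i))` (`aperyB`, `aperyC`, `aperyD`; `b₁ = 6`), and
the `p`-adic norm bookkeeping of its terms at `n = kp`, `k < p` (Legendre/Kummer/Lucas via Mathlib's
`padicValNat_choose'`, `Nat.factorization_choose_le_log`, `Choose.choose_modEq_choose_mod_mul_choose_div_nat`):
`‖p³c_{kp,j}‖_p ≤ p`, `‖c_{k,j}‖_p ≤ p`, `‖c_{k,j}‖_p ≤ 1` for `k + j < p`. The congruence is assembled in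
`AperyDworkCongruence.lean`; the identification of `aperyB` with the recurrence solution is NOT needed there.
-/

namespace Summit.KontsevichZagierPeriods.Zeta5Search.AperyDwork

open Finset
open Literature.Combinatorics.Enumerative.AperyNumbers (aperyTerm)
open Literature.NumberTheory.Transcendental.Apery (H3 H3_zero H3_succ)

/-! ## Apéry's second solution in explicit form -/

/-- `D(n,i) = 2 i³ C(n,i) C(n+i,i)`, the denominator of the inner Apéry term. -/
def aperyD (n i : ℕ) : ℕ := 2 * i ^ 3 * n.choose i * (n + i).choose i

/-- `c_{n,j} = Σ_{m=1}^{n} 1/m³ + Σ_{i=1}^{j} (−1)^{i−1} / (2 i³ C(n,i) C(n+i,i))` (the inner sum indexed by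
`i ↦ i+1`, so the sign is `(−1)^i`). -/
def aperyC (n j : ℕ) : ℚ := H3 n + ∑ i ∈ range j, (-1 : ℚ) ^ i / (aperyD n (i + 1) : ℚ)

/-- Apéry's second solution `b_n = Σ_{j=0}^{n} C(n,j)² C(n+j,j)² c_{n,j}` (`0, 6, 351/4, 62531/36, …`). -/
def aperyB (n : ℕ) : ℚ := ∑ j ∈ range (n + 1), (aperyTerm n j : ℚ) * aperyC n j

/-- `b₁ = 6`. -/
theorem aperyB_one : aperyB 1 = 6 := by
  simp [aperyB, aperyC, aperyD, H3, aperyTerm, sum_range_succ]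
  norm_num

/-- `D(n,i) ≠ 0` for `1 ≤ i ≤ n`. -/
theorem aperyD_ne_zero {n i : ℕ} (hi : 1 ≤ i) (hin : i ≤ n) : aperyD n i ≠ 0 := by
  unfold aperyD
  have h1 : n.choose i ≠ 0 := (Nat.choose_pos hin).ne'
  have h2 : (n + i).choose i ≠ 0 := (Nat.choose_pos (by omega)).ne'
  positivity

/-! ## `p`-adic norm helpers -/
section Norms

variable {p : ℕ} [hp : Fact p.Prime]

/-- `‖p^e‖_p = p^{−e}`. -/
theorem padicNorm_p_pow (e : ℕ) : padicNorm p ((p : ℚ) ^ e) = (p : ℚ) ^ (-(e : ℤ)) := by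
  have hp0 : (p : ℚ) ≠ 0 := Nat.cast_ne_zero.mpr hp.out.ne_zero
  rw [padicNorm.eq_zpow_of_nonzero (pow_ne_zero _ hp0), padicValRat.pow,
    padicValRat.self hp.out.one_lt]
  simp

omit hp in
/-- `‖m‖_p = p^{−v_p(m)}` for a nonzero natural number `m`. -/
theorem padicNorm_natCast {m : ℕ} (hm : m ≠ 0) :
    padicNorm p (m : ℚ) = (p : ℚ) ^ (-(padicValNat p m : ℤ)) := by
  rw [padicNorm.eq_zpow_of_nonzero (Nat.cast_ne_zero.mpr hm), ← padicValRat_of_nat]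

/-- `‖p^e / D‖_p = p^{v_p(D) − e}` for a nonzero natural number `D`. -/
theorem padicNorm_p_pow_div_natCast (e : ℕ) {D : ℕ} (hD : D ≠ 0) :
    padicNorm p ((p : ℚ) ^ e / D) = (p : ℚ) ^ ((padicValNat p D : ℤ) - e) := by
  have hp0 : (p : ℚ) ≠ 0 := Nat.cast_ne_zero.mpr hp.out.ne_zero
  rw [padicNorm.div, padicNorm_p_pow, padicNorm_natCast hD, ← zpow_sub₀ hp0]
  congr 1
  ring

omit hp in
/-- A sign `(−1)^i` does not change the `p`-adic norm. -/
theorem padicNorm_neg_one_pow_mul (i : ℕ) (x : ℚ) :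
    padicNorm p ((-1 : ℚ) ^ i * x) = padicNorm p x := by
  rcases Nat.even_or_odd i with h | h
  · rw [h.neg_one_pow, one_mul]
  · rw [h.neg_one_pow, neg_one_mul, padicNorm.neg]

/-- A natural number divisible by `p` has norm `≤ p⁻¹`. -/
theorem padicNorm_natCast_le_inv_of_dvd {m : ℕ} (h : p ∣ m) : padicNorm p (m : ℚ) ≤ (p : ℚ) ^ (-1 : ℤ) := by
  have h' : ((p ^ 1 : ℕ) : ℤ) ∣ (m : ℤ) := by rw [pow_one]; exact_mod_cast h
  have := padicNorm.dvd_iff_norm_le.mp h'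
  simpa using this

end Norms

/-! ## Valuations of the binomials at `n = kp` (Legendre / Kummer / Lucas) -/
section Valuations

variable {p : ℕ} [hp : Fact p.Prime]

omit hp in
/-- `v_p(m) ≤ 1` for `m < p²`. -/
theorem padicValNat_le_one_of_lt_sq {m : ℕ} (hm : m < p ^ 2) : padicValNat p m ≤ 1 := by
  rcases Nat.eq_zero_or_pos m with rfl | hm0
  · simp
  have h := padicValNat_le_nat_log (p := p) m
  have : Nat.log p m < 2 := Nat.log_lt_of_lt_pow (by omega) hm
  omega

/-- `v_p(C(n,i)) ≤ log_p n`. -/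
theorem padicValNat_choose_le_log (n i : ℕ) : padicValNat p (n.choose i) ≤ Nat.log p n := by
  rw [← Nat.factorization_def _ hp.out]
  exact Nat.factorization_choose_le_log

/-- `v_p(C(n,i)) < e` for `n < p^e` (`e ≠ 0`). -/
theorem padicValNat_choose_lt {n i e : ℕ} (he : e ≠ 0) (hn : n < p ^ e) :
    padicValNat p (n.choose i) < e := by
  rcases Nat.eq_zero_or_pos n with rfl | hn0
  · rcases i with _ | i <;> simp [Nat.pos_of_ne_zero he]
  exact (padicValNat_choose_le_log n i).trans_lt (Nat.log_lt_of_lt_pow (by omega) hn)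

/-- `v_p(C(n,i)) = 0` for `n < p`. -/
theorem padicValNat_choose_eq_zero {n i : ℕ} (hn : n < p) : padicValNat p (n.choose i) = 0 := by
  have h := padicValNat_choose_le_log (p := p) n i
  rw [Nat.log_of_lt hn] at h
  omega

/-- Lucas on multiples of `p`: `C(Kp, Ip) ≡ C(K, I) (mod p)`. -/
theorem cast_choose_mul_p (K I : ℕ) :
    (((K * p).choose (I * p) : ℕ) : ZMod p) = ((K.choose I : ℕ) : ZMod p) := by
  have h := Choose.choose_modEq_choose_mod_mul_choose_div_nat (n := K * p) (k := I * p) (p := p)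
  rw [Nat.mul_mod_left, Nat.mul_mod_left, Nat.mul_div_cancel _ hp.out.pos,
    Nat.mul_div_cancel _ hp.out.pos, Nat.choose_zero_right, one_mul] at h
  exact (ZMod.natCast_eq_natCast_iff _ _ _).mpr h

/-- Lucas: `p ∣ C(kp, i)` whenever `p ∤ i`. -/
theorem dvd_choose_mul_p_of_not_dvd (k i : ℕ) (hi : ¬ p ∣ i) : p ∣ (k * p).choose i := by
  have h := Choose.choose_modEq_choose_mod_mul_choose_div_nat (n := k * p) (k := i) (p := p)
  have hi' : 0 < i % p := Nat.pos_of_ne_zero (fun h0 => hi (Nat.dvd_of_mod_eq_zero h0))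
  rw [Nat.mul_mod_left, Nat.choose_eq_zero_of_lt hi', zero_mul] at h
  exact Nat.modEq_zero_iff_dvd.mp h

/-- `C(kp, sp)` is a `p`-adic unit for `s ≤ k < p`. -/
theorem padicValNat_choose_mul_p_eq_zero {k s : ℕ} (hk : k < p) (hsk : s ≤ k) :
    padicValNat p ((k * p).choose (s * p)) = 0 := by
  apply padicValNat.eq_zero_of_not_dvd
  intro hd
  have h1 : (((k * p).choose (s * p) : ℕ) : ZMod p) = 0 := (ZMod.natCast_eq_zero_iff _ _).mpr hd
  rw [cast_choose_mul_p] at h1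
  have h2 : p ∣ k.choose s := (ZMod.natCast_eq_zero_iff _ _).mp h1
  have h3 := one_le_padicValNat_of_dvd (Nat.choose_pos hsk).ne' h2
  have h4 := padicValNat_choose_eq_zero (p := p) (i := s) hk
  omega

/-- Kummer on a block: `v_p(C(kp + sp, sp)) ≤ 1` for `k, s < p` (one carry at most). -/
theorem padicValNat_choose_block_le_one {k s : ℕ} (hk : k < p) (hs : s < p) :
    padicValNat p ((k * p + s * p).choose (s * p)) ≤ 1 := by
  rcases Nat.eq_zero_or_pos (k * p + s * p) with h0 | h0
  · rw [h0]
    have : s * p = 0 := by omega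
    simp [this]
  have hlt : k * p + s * p < p ^ 3 := by
    have : k * p + s * p < 2 * p * p := by nlinarith [hp.out.pos]
    calc k * p + s * p < 2 * p * p := this
      _ ≤ p * p * p := by nlinarith [hp.out.two_le, hp.out.pos]
      _ = p ^ 3 := by ring
  have hlog : Nat.log p (k * p + s * p) < 3 := Nat.log_lt_of_lt_pow (by omega) hlt
  rw [padicValNat_choose' hlog]
  have hIco : Finset.Ico 1 3 = {1, 2} := by decide
  rw [hIco, Finset.filter_insert]
  have h1 : ¬ (p ^ 1 ≤ s * p % p ^ 1 + k * p % p ^ 1) := by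
    simp [Nat.mul_mod_left, hp.out.ne_zero]
  rw [if_neg h1]
  exact (Finset.card_filter_le _ _).trans (by simp)

/-- `p ∣ C(k+s, s)` when `k, s < p ≤ k + s`. -/
theorem dvd_choose_add_of_ge {k s : ℕ} (hk : k < p) (hs : s < p) (h : p ≤ k + s) :
    p ∣ (k + s).choose s := by
  have := Nat.Prime.dvd_choose_add hp.out hs hk (by omega)
  rwa [Nat.add_comm] at this

/-- `p ∣ C(kp + sp, sp)` when `k, s < p ≤ k + s` (Lucas then the one-digit carry). -/
theorem dvd_choose_block_of_ge {k s : ℕ} (hk : k < p) (hs : s < p) (h : p ≤ k + s) :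
    p ∣ (k * p + s * p).choose (s * p) := by
  have e : k * p + s * p = (k + s) * p := by ring
  rw [e, ← ZMod.natCast_eq_zero_iff, cast_choose_mul_p, ZMod.natCast_eq_zero_iff]
  exact dvd_choose_add_of_ge hk hs h

end Valuations

/-! ## Norms of the terms of `c_{kp,j}` and `c_{k,j}` -/
section Terms

variable {p : ℕ} [hp : Fact p.Prime]

/-- `v_p(2) = 0` for an odd prime `p`. -/
theorem padicValNat_two_eq_zero (hp2 : p ≠ 2) : padicValNat p 2 = 0 :=
  padicValNat_primes hp2

/-- Harmonic terms: `‖p³/m³‖_p ≤ 1` for `0 < m < p²`. -/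
theorem norm_H3_term_le_one {m : ℕ} (hm0 : m ≠ 0) (hm : m < p ^ 2) :
    padicNorm p ((p : ℚ) ^ 3 / ((m ^ 3 : ℕ) : ℚ)) ≤ 1 := by
  rw [padicNorm_p_pow_div_natCast 3 (pow_ne_zero 3 hm0), padicValNat.pow m 3]
  have h := padicValNat_le_one_of_lt_sq (p := p) hm
  have h1 : (1 : ℚ) < p := by exact_mod_cast hp.out.one_lt
  rw [zpow_le_one_iff_right₀ h1]
  omega

/-- Harmonic terms off the multiples of `p`: `‖p³/m³‖_p ≤ p⁻³ < 1` hence `< 1` for `p ∤ m`. -/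
theorem norm_H3_term_lt_one {m : ℕ} (hm0 : m ≠ 0) (hm : ¬ p ∣ m) :
    padicNorm p ((p : ℚ) ^ 3 / ((m ^ 3 : ℕ) : ℚ)) < 1 := by
  rw [padicNorm_p_pow_div_natCast 3 (pow_ne_zero 3 hm0), padicValNat.pow m 3,
    padicValNat.eq_zero_of_not_dvd hm]
  have h1 : (1 : ℚ) < p := by exact_mod_cast hp.out.one_lt
  rw [zpow_lt_one_iff_right₀ h1]
  omega

/-- Valuation of `D(kp,i)` off the multiples of `p`: `v_p(D(kp,i)) ≤ 3` (`1 ≤ i ≤ kp`, `k < p`, `p ∤ i`, `p` odd),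
and `≤ 2` when moreover `kp + i < p²`. -/
theorem padicValNat_aperyD_of_not_dvd (hp2 : p ≠ 2) {k i : ℕ} (hk : k < p) (hi1 : 1 ≤ i)
    (hik : i ≤ k * p) (hi : ¬ p ∣ i) :
    padicValNat p (aperyD (k * p) i) ≤ 3 ∧
      (k * p + i < p ^ 2 → padicValNat p (aperyD (k * p) i) ≤ 2) := by
  have hC1 : (k * p).choose i ≠ 0 := (Nat.choose_pos hik).ne'
  have hC2 : (k * p + i).choose i ≠ 0 := (Nat.choose_pos (by omega)).ne'
  have hi0 : i ≠ 0 := by omega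
  have hkp : k * p < p ^ 2 := by nlinarith [hp.out.pos]
  have hkpi : k * p + i < p ^ 3 := by
    have : k * p + i ≤ 2 * (k * p) := by omega
    calc k * p + i ≤ 2 * (k * p) := this
      _ < 2 * p ^ 2 := by nlinarith [hp.out.pos]
      _ ≤ p ^ 3 := by nlinarith [hp.out.two_le, pow_pos hp.out.pos 2]
  unfold aperyD
  rw [padicValNat.mul (by positivity) hC2, padicValNat.mul (by positivity) hC1,
    padicValNat.mul (by norm_num) (pow_ne_zero 3 hi0), padicValNat.pow i 3,
    padicValNat_two_eq_zero hp2, padicValNat.eq_zero_of_not_dvd hi]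
  have h1 := padicValNat_choose_lt (p := p) (i := i) two_ne_zero hkp
  have h2 := padicValNat_choose_lt (p := p) (i := i) three_ne_zero hkpi
  refine ⟨by omega, fun hlt => ?_⟩
  have h3 := padicValNat_choose_lt (p := p) (i := i) two_ne_zero hlt
  omega

/-- Valuation of `D(kp, sp)` on the multiples of `p`: `v_p ≤ 4` (`1 ≤ s ≤ k < p`, `p` odd). -/
theorem padicValNat_aperyD_mul_p (hp2 : p ≠ 2) {k s : ℕ} (hk : k < p) (hs1 : 1 ≤ s) (hsk : s ≤ k) :
    padicValNat p (aperyD (k * p) (s * p)) ≤ 4 := by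
  have hs0 : s ≠ 0 := by omega
  have hsp0 : s * p ≠ 0 := Nat.mul_ne_zero hs0 hp.out.ne_zero
  have hC1 : (k * p).choose (s * p) ≠ 0 := (Nat.choose_pos (Nat.mul_le_mul_right p hsk)).ne'
  have hC2 : (k * p + s * p).choose (s * p) ≠ 0 := (Nat.choose_pos (by omega)).ne'
  unfold aperyD
  rw [padicValNat.mul (by positivity) hC2, padicValNat.mul (by positivity) hC1,
    padicValNat.mul (by norm_num) (pow_ne_zero 3 hsp0), padicValNat.pow (s * p) 3,
    padicValNat_two_eq_zero hp2, padicValNat.mul hs0 hp.out.ne_zero, padicValNat_self,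
    padicValNat.eq_zero_of_not_dvd (fun h => absurd (Nat.le_of_dvd (by omega) h) (by omega)),
    padicValNat_choose_mul_p_eq_zero hk hsk]
  have h := padicValNat_choose_block_le_one (p := p) hk (by omega : s < p)
  omega

/-- Valuation of `D(k,i)` for `1 ≤ i ≤ k < p`: `v_p(D(k,i)) ≤ 1`, and `= 0` when `k + i < p` (`p` odd). -/
theorem padicValNat_aperyD_small (hp2 : p ≠ 2) {k i : ℕ} (hk : k < p) (hi1 : 1 ≤ i) (hik : i ≤ k) :
    padicValNat p (aperyD k i) ≤ 1 ∧ (k + i < p → padicValNat p (aperyD k i) = 0) := by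
  have hi0 : i ≠ 0 := by omega
  have hC1 : k.choose i ≠ 0 := (Nat.choose_pos hik).ne'
  have hC2 : (k + i).choose i ≠ 0 := (Nat.choose_pos (by omega)).ne'
  have hki : k + i < p ^ 2 := by nlinarith [hp.out.two_le]
  unfold aperyD
  rw [padicValNat.mul (by positivity) hC2, padicValNat.mul (by positivity) hC1,
    padicValNat.mul (by norm_num) (pow_ne_zero 3 hi0), padicValNat.pow i 3,
    padicValNat_two_eq_zero hp2, padicValNat_choose_eq_zero (i := i) hk,
    padicValNat.eq_zero_of_not_dvd (fun h => absurd (Nat.le_of_dvd (by omega) h) (by omega))]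
  have h1 := padicValNat_choose_lt (p := p) (i := i) two_ne_zero hki
  exact ⟨by omega, fun hlt => by rw [padicValNat_choose_eq_zero (i := i) hlt]⟩

/-- Term bound at `n = kp`: `‖p³ · (−1)^e / D(kp,i)‖_p ≤ p` for every `1 ≤ i ≤ kp` (`k < p`, `p` odd). -/
theorem norm_term_kp_le (hp2 : p ≠ 2) {k i : ℕ} (hk : k < p) (hi1 : 1 ≤ i) (hik : i ≤ k * p) (e : ℕ) :
    padicNorm p ((p : ℚ) ^ 3 * ((-1 : ℚ) ^ e / (aperyD (k * p) i : ℚ))) ≤ p := by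
  have hD : aperyD (k * p) i ≠ 0 := aperyD_ne_zero hi1 hik
  have h1 : (1 : ℚ) < p := by exact_mod_cast hp.out.one_lt
  rw [show (p : ℚ) ^ 3 * ((-1 : ℚ) ^ e / (aperyD (k * p) i : ℚ))
      = (-1 : ℚ) ^ e * ((p : ℚ) ^ 3 / (aperyD (k * p) i : ℚ)) by ring,
    padicNorm_neg_one_pow_mul, padicNorm_p_pow_div_natCast 3 hD]
  conv_rhs => rw [← zpow_one (p : ℚ)]
  rw [zpow_le_zpow_iff_right₀ h1]
  by_cases hpi : p ∣ i
  · obtain ⟨s, rfl⟩ := hpi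
    rw [Nat.mul_comm p s] at hik hD hi1 ⊢
    have hs1 : 1 ≤ s := by
      rcases Nat.eq_zero_or_pos s with rfl | h
      · simp at hi1
      · exact h
    have hsk : s ≤ k := Nat.le_of_mul_le_mul_right hik hp.out.pos
    have h := padicValNat_aperyD_mul_p hp2 hk hs1 hsk
    omega
  · have h := (padicValNat_aperyD_of_not_dvd hp2 hk hi1 hik hpi).1
    omega

/-- Term bound at `n = kp`, off the multiples of `p` and below `p²`: `‖p³ · (−1)^e / D(kp,i)‖_p < 1`. -/
theorem norm_term_kp_lt_one (hp2 : p ≠ 2) {k i : ℕ} (hk : k < p) (hi1 : 1 ≤ i) (hik : i ≤ k * p)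
    (hpi : ¬ p ∣ i) (hlt : k * p + i < p ^ 2) (e : ℕ) :
    padicNorm p ((p : ℚ) ^ 3 * ((-1 : ℚ) ^ e / (aperyD (k * p) i : ℚ))) < 1 := by
  have hD : aperyD (k * p) i ≠ 0 := aperyD_ne_zero hi1 hik
  have h1 : (1 : ℚ) < p := by exact_mod_cast hp.out.one_lt
  rw [show (p : ℚ) ^ 3 * ((-1 : ℚ) ^ e / (aperyD (k * p) i : ℚ))
      = (-1 : ℚ) ^ e * ((p : ℚ) ^ 3 / (aperyD (k * p) i : ℚ)) by ring,
    padicNorm_neg_one_pow_mul, padicNorm_p_pow_div_natCast 3 hD, zpow_lt_one_iff_right₀ h1]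
  have h := (padicValNat_aperyD_of_not_dvd hp2 hk hi1 hik hpi).2 hlt
  omega

/-- Term bound at `n = k < p`: `‖(−1)^e / D(k,i)‖_p ≤ p` for `1 ≤ i ≤ k` (`p` odd). -/
theorem norm_term_small_le (hp2 : p ≠ 2) {k i : ℕ} (hk : k < p) (hi1 : 1 ≤ i) (hik : i ≤ k) (e : ℕ) :
    padicNorm p ((-1 : ℚ) ^ e / (aperyD k i : ℚ)) ≤ p := by
  have hD : aperyD k i ≠ 0 := aperyD_ne_zero hi1 hik
  have h1 : (1 : ℚ) < p := by exact_mod_cast hp.out.one_lt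
  rw [show ((-1 : ℚ) ^ e / (aperyD k i : ℚ)) = (-1 : ℚ) ^ e * ((p : ℚ) ^ 0 / (aperyD k i : ℚ)) by ring,
    padicNorm_neg_one_pow_mul, padicNorm_p_pow_div_natCast 0 hD]
  conv_rhs => rw [← zpow_one (p : ℚ)]
  rw [zpow_le_zpow_iff_right₀ h1]
  have h := (padicValNat_aperyD_small hp2 hk hi1 hik).1
  omega

/-- Term bound at `n = k` with `k + i < p`: `‖(−1)^e / D(k,i)‖_p ≤ 1` (`p` odd). -/
theorem norm_term_small_le_one (hp2 : p ≠ 2) {k i : ℕ} (hk : k < p) (hi1 : 1 ≤ i) (hik : i ≤ k)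
    (hlt : k + i < p) (e : ℕ) :
    padicNorm p ((-1 : ℚ) ^ e / (aperyD k i : ℚ)) ≤ 1 := by
  have hD : aperyD k i ≠ 0 := aperyD_ne_zero hi1 hik
  have h1 : (1 : ℚ) < p := by exact_mod_cast hp.out.one_lt
  rw [show ((-1 : ℚ) ^ e / (aperyD k i : ℚ)) = (-1 : ℚ) ^ e * ((p : ℚ) ^ 0 / (aperyD k i : ℚ)) by ring,
    padicNorm_neg_one_pow_mul, padicNorm_p_pow_div_natCast 0 hD, zpow_le_one_iff_right₀ h1]
  have h := (padicValNat_aperyD_small hp2 hk hi1 hik).2 hlt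
  omega

end Terms

/-! ## Norm bounds for `c_{kp,j}` and `c_{k,j}` -/
section Cbounds

variable {p : ℕ} [hp : Fact p.Prime]

/-- `‖p³ · H₃(n)‖_p ≤ 1` for `n < p²` (`H₃(n) = Σ_{m ≤ n} m⁻³`). -/
theorem norm_p3_H3_le_one {n : ℕ} (hn : n < p ^ 2) : padicNorm p ((p : ℚ) ^ 3 * H3 n) ≤ 1 := by
  unfold H3
  rw [Finset.mul_sum]
  apply padicNorm.sum_le' _ zero_le_one
  intro m hm
  simp only [mem_range] at hm
  have e : (p : ℚ) ^ 3 * (1 / ((m : ℚ) + 1) ^ 3) = (p : ℚ) ^ 3 / (((m + 1) ^ 3 : ℕ) : ℚ) := by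
    push_cast; ring
  rw [e]
  exact norm_H3_term_le_one (by omega) (by omega)

/-- `‖H₃(n)‖_p ≤ 1` for `n < p`. -/
theorem norm_H3_le_one {n : ℕ} (hn : n < p) : padicNorm p (H3 n) ≤ 1 := by
  unfold H3
  apply padicNorm.sum_le' _ zero_le_one
  intro m hm
  simp only [mem_range] at hm
  have hm0 : (m + 1) ^ 3 ≠ 0 := by positivity
  have e : (1 / ((m : ℚ) + 1) ^ 3) = (p : ℚ) ^ 0 / (((m + 1) ^ 3 : ℕ) : ℚ) := by
    push_cast; ring
  rw [e, padicNorm_p_pow_div_natCast 0 hm0, padicValNat.pow (m + 1) 3,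
    padicValNat.eq_zero_of_not_dvd (fun h => absurd (Nat.le_of_dvd (by omega) h) (by omega))]
  simp

/-- **L1.** `‖p³ · c_{kp,j}‖_p ≤ p` for `j ≤ kp`, `k < p`, `p` odd. -/
theorem norm_p3_aperyC_kp_le (hp2 : p ≠ 2) {k j : ℕ} (hk : k < p) (hj : j ≤ k * p) :
    padicNorm p ((p : ℚ) ^ 3 * aperyC (k * p) j) ≤ p := by
  have hkp : k * p < p ^ 2 := by nlinarith [hp.out.pos]
  have hp1 : (1 : ℚ) ≤ p := by exact_mod_cast hp.out.one_lt.le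
  unfold aperyC
  rw [mul_add, Finset.mul_sum]
  refine (padicNorm.nonarchimedean).trans (max_le ((norm_p3_H3_le_one hkp).trans hp1) ?_)
  apply padicNorm.sum_le' _ (by positivity)
  intro i hi
  simp only [mem_range] at hi
  exact norm_term_kp_le hp2 hk (by omega) (by omega) i

/-- **L1'.** `‖c_{k,j}‖_p ≤ p` for `j ≤ k < p`, `p` odd. -/
theorem norm_aperyC_small_le (hp2 : p ≠ 2) {k j : ℕ} (hk : k < p) (hj : j ≤ k) :
    padicNorm p (aperyC k j) ≤ p := by
  have hp1 : (1 : ℚ) ≤ p := by exact_mod_cast hp.out.one_lt.le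
  unfold aperyC
  refine (padicNorm.nonarchimedean).trans (max_le ((norm_H3_le_one hk).trans hp1) ?_)
  apply padicNorm.sum_le' _ (by positivity)
  intro i hi
  simp only [mem_range] at hi
  exact norm_term_small_le hp2 hk (by omega) (by omega) i

/-- **L3.** `‖c_{k,j}‖_p ≤ 1` for `j ≤ k`, `k + j < p`, `p` odd. -/
theorem norm_aperyC_small_le_one (hp2 : p ≠ 2) {k j : ℕ} (hk : k < p) (hj : j ≤ k) (hkj : k + j < p) :
    padicNorm p (aperyC k j) ≤ 1 := by
  unfold aperyC
  refine (padicNorm.nonarchimedean).trans (max_le (norm_H3_le_one hk) ?_)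
  apply padicNorm.sum_le' _ zero_le_one
  intro i hi
  simp only [mem_range] at hi
  exact norm_term_small_le_one hp2 hk (by omega) (by omega) (by omega) i

end Cbounds

end Summit.KontsevichZagierPeriods.Zeta5Search.AperyDwork
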